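import Literature.Probability.RandomPlanarGeometry.HexSAWPolygonRatio
import Literature.Probability.RandomPlanarGeometry.HexSAWRatioLimit
import Literature.Probability.RandomPlanarGeometry.SAWEndpointRateUpper
import Literature.Probability.RandomPlanarGeometry.HexSAWHammersleyWelshSix
import HarnessLib

/-!
# Kesten's upper ratio RATE for fixed-endpoint walks and polygons on the honeycomb lattice:
# `c_{N+2}(0,x;ℍ)/c_N(0,x;ℍ) − (2+√2) ≤ K·N^{-1/4}` («HEX-ENDPOINT-RATIO-2-RATE», upper side)

Topic `Literature/Probability/RandomPlanarGeometry` (lane «pcv-sawmu», a-p4 g7; continues `HexSAWEndpointKesten.lean` —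
`HV.HexEndpointLo`, `hexEndpointKestenTwo_of`, `hexEndpointRatioTwo_of` —, `HexSAWPolygonRatio.lean` — the unconditional polygon
envelope `HV.hexAdjEndLo` —, `HexSAWRatioLimit.lean` — the walk-class inequality
`HV.kestenIneqHex` and limit `HV.hexRatioTwo` — and the abstract engine `Zd.KestenRateUpper.upper_rate_fourthRoot` of
`SAWEndpointRateUpper.lean`).

Source: N. Madras, G. Slade, *The Self-Avoiding Walk* (1993), §7.5, eq. (7.5.2) p. 255 (Kesten 1963): for fixed `x ≠ 0`,
"`−K N^{−1/3} ≤ c_{N+2}(0,x)/c_N(0,x) − μ² ≤ K N^{−1/4}`" (`ℤ^d`, stated without proof; tree twin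
`Zd.Kesten1963_ratioRate_endpoint_allDim`). THIS FILE proves the UPPER half on `ℍ` (exponent `1/4`), conditional on the displayed
envelope `HexEndpointLo x c δ` for a general endpoint `x`, and UNCONDITIONALLY for polygons (`hexPolygonRatioTwo_upperRate`: walks to a
fixed neighbour of the origin = rooted polygons through that edge; the restatement with a-p6's `hexPolygonCount` is the sequel
`HexSAWPolygonCountRatio.lean`).
Mechanism (no new idea): the engine is applied to the SPLICED sequence `a_N := #E_N(x)` for `N ≡ δ (mod 2)`, `N ≥ N₀`, and
`a_N := c_N(ℍ)` otherwise (the `ℤ²` device `spliceW` of `SAWEndpointRatioLimit.lean`): both classes satisfy Kesten's two-step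
inequality (endpoint class: `hexEndpointKestenTwo_of`; walk class: `HV.kestenIneqHex`), made ADDITIVE through the two ratio limits
(`φ ≥ 1` eventually) and extended to all `n ≥ 1` by absorbing the finitely many small/seam indices into the constant; the envelopes
are `e^{−c√N} μ_ℍ^N ≤ a_N ≤ e^{7√(N+1)} μ_ℍ^N` (`hexConnectiveConstant_pow_le`, `hexHWExplicit_mu_six`, `hLo`). The LOWER half
(exponent `1/3`) needs polygon concatenation on `ℍ` and is not treated here.

Status in print: `ℤ^d` — (7.5.2) stated (Kesten 1963), upper half proved in the tree for every `d`; `ℍ`: nothing printed (lane lit-1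
cells); label «CONSOLIDATION — Kesten's ¼ upper rate carried to `ℍ`; first written + kernel text».

## Contents (namespace `Literature.Probability.RandomPlanarGeometry.SAW.HV`; all PROVED, axioms standard)

* `spliceE x δ N₀` and its case lemmas; `sub_le_of_kesten_sq` (multiplicative ⇒ additive Kesten step when `φ ≥ 1`);
* `spliceE_pos`, `spliceE_lower`, `spliceE_upper`, `spliceE_additive_all` (the engine's hypotheses);
* **`hexEndpointRatioTwo_upperRate_of (hδ : δ ≤ 1) (hc : 0 ≤ c) (hLo : HexEndpointLo x c δ) :
  ∃ K, ∃ m₁, ∀ m ≥ m₁, #E_{2m+δ+2}(x)/#E_{2m+δ}(x) − (2+√2) ≤ K·m^{-1/4}`**;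
* **`hexPolygonRatioTwo_upperRate (hz : hvGraph.Adj hvOrigin z) : ∃ K m₁, ∀ m ≥ m₁, #E_{2m+3}(z)/#E_{2m+1}(z) − (2+√2) ≤ K·m^{-1/4}`**
  (rooted polygons through the edge `{0,z}`; no hypotheses).
-/

noncomputable section

open Finset Filter Topology Literature.Probability.LatticeModels SimpleGraph

namespace Literature.Probability.RandomPlanarGeometry.SAW.HV

/-! ### The spliced sequence -/

section Splice

variable {x : HV} {c : ℝ} {δ : ℕ}

/-- The spliced sequence: fixed-endpoint counts on the class `N ≡ δ (mod 2)`, `N ≥ N₀`; all-walk counts elsewhere.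
[cite: MadrasSlade1993, Theorem 7.3.4 (b) (proof: Lemma 7.3.1 applied along the parity class)] -/
def spliceE (x : HV) (δ N₀ : ℕ) (N : ℕ) : ℝ :=
  if N % 2 = δ % 2 ∧ N₀ ≤ N then (#(endFin x N) : ℝ) else (hexSawCount N : ℝ)

/-- On the class. [cite: MadrasSlade1993, Theorem 7.3.4 (b)] -/
theorem spliceE_of_class {N₀ N : ℕ} (h : N % 2 = δ % 2 ∧ N₀ ≤ N) : spliceE x δ N₀ N = #(endFin x N) := by
  simp only [spliceE, if_pos h]

/-- Off the class. [cite: MadrasSlade1993, Theorem 7.3.4 (b)] -/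
theorem spliceE_of_not {N₀ N : ℕ} (h : ¬(N % 2 = δ % 2 ∧ N₀ ≤ N)) : spliceE x δ N₀ N = hexSawCount N := by
  simp only [spliceE, if_neg h]

/-- Multiplicative ⇒ additive Kesten step: `p² − D/n ≤ p q`, `p ≥ 1` ⇒ `p − max(D,0)/n ≤ q`.
[cite: MadrasSlade1993, Lemma 7.3.1 (proof, (7.3.1) ⇒ (7.3.3))] -/
theorem sub_le_of_kesten_sq {p q D : ℝ} {n : ℕ} (hp : 1 ≤ p) (h : p ^ 2 - D / n ≤ p * q) :
    p - max D 0 / n ≤ q := by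
  have hp0 : 0 < p := by linarith
  rcases Nat.eq_zero_or_pos n with rfl | hn
  · simp only [Nat.cast_zero, div_zero, sub_zero] at h ⊢
    nlinarith
  have hnr : (0 : ℝ) < n := by exact_mod_cast hn
  -- `p - q ≤ D/(n p)`
  have h1 : p * (p - q) ≤ D / n := by nlinarith
  rcases le_or_gt 0 D with hD | hD
  · rw [max_eq_left hD]
    -- `p (p - q) ≤ D/n` and `p ≥ 1` ⇒ `p - q ≤ D/n`
    by_contra hcon
    push Not at hcon
    have hpq : 0 < p - q := by
      have : 0 ≤ D / n := div_nonneg hD hnr.le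
      linarith
    have : D / n < p * (p - q) := by nlinarith
    linarith
  · rw [max_eq_right hD.le, zero_div, sub_zero]
    have : D / n < 0 := div_neg_of_neg_of_pos hD hnr
    nlinarith

variable (hδ : δ ≤ 1) (hc : 0 ≤ c)

/-- Class indices `N ≡ δ`, `N ≥ 2m₀+δ` are `N = 2m+δ` with `m ≥ m₀`. [folklore] -/
private theorem exists_eq_of_class {m₀ N : ℕ} (hδ : δ ≤ 1) (h : N % 2 = δ % 2 ∧ 2 * m₀ + δ ≤ N) :
    ∃ m : ℕ, m₀ ≤ m ∧ N = 2 * m + δ := by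
  obtain ⟨hpar, hN⟩ := h
  refine ⟨(N - δ) / 2, ?_, ?_⟩ <;> omega

/-- **Positivity and the lower envelope of the spliced sequence** (`N₀ = 2m₀+δ` from the envelope hypothesis).
[cite: MadrasSlade1993, Corollary 3.2.6 (3.2.10) p. 68; §1.2 (1.2.10) (μ^N ≤ c_N)] -/
theorem spliceE_lower {m₀ : ℕ} (hc : 0 ≤ c) (hδ : δ ≤ 1)
    (hm₀ : ∀ m : ℕ, m₀ ≤ m →
      Real.exp (-(c * Real.sqrt ((2 * m + δ : ℕ) : ℝ))) * hexConnectiveConstant ^ (2 * m + δ) ≤ #(endFin x (2 * m + δ)))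
    (N : ℕ) : Real.exp (-(c * Real.sqrt (N : ℝ))) * hexConnectiveConstant ^ N ≤ spliceE x δ (2 * m₀ + δ) N := by
  by_cases h : N % 2 = δ % 2 ∧ 2 * m₀ + δ ≤ N
  · rw [spliceE_of_class h]
    obtain ⟨m, hm, rfl⟩ := exists_eq_of_class hδ h
    exact hm₀ m hm
  · rw [spliceE_of_not h]
    have h1 : Real.exp (-(c * Real.sqrt (N : ℝ))) ≤ 1 := by
      rw [Real.exp_le_one_iff]; have := Real.sqrt_nonneg (N : ℝ); nlinarith
    have hμ := hexConnectiveConstant_pos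
    calc Real.exp (-(c * Real.sqrt (N : ℝ))) * hexConnectiveConstant ^ N ≤ 1 * hexConnectiveConstant ^ N :=
          mul_le_mul_of_nonneg_right h1 (by positivity)
      _ = hexConnectiveConstant ^ N := one_mul _
      _ ≤ hexSawCount N := hexConnectiveConstant_pow_le N

/-- Positivity of the spliced sequence. [cite: MadrasSlade1993, Corollary 3.2.6] -/
theorem spliceE_pos {m₀ : ℕ} (hc : 0 ≤ c) (hδ : δ ≤ 1)
    (hm₀ : ∀ m : ℕ, m₀ ≤ m →
      Real.exp (-(c * Real.sqrt ((2 * m + δ : ℕ) : ℝ))) * hexConnectiveConstant ^ (2 * m + δ) ≤ #(endFin x (2 * m + δ)))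
    (N : ℕ) : 0 < spliceE x δ (2 * m₀ + δ) N := by
  have hμ := hexConnectiveConstant_pos
  exact lt_of_lt_of_le (by positivity) (spliceE_lower hc hδ hm₀ N)

/-- **Upper envelope**: `spliceE N ≤ c_N(ℍ) ≤ e^{7√(N+1)} μ_ℍ^N` (Hammersley–Welsh on `ℍ`, `hexHWExplicit_mu_six`, and `μ_ℍ ≤ e`).
[cite: HammersleyWelsh1962, Theorem; MadrasSlade1993, Corollary 3.1.6 (3.1.9)] -/
theorem spliceE_upper (N₀ N : ℕ) :
    spliceE x δ N₀ N ≤ Real.exp (7 * Real.sqrt ((N : ℝ) + 1)) * hexConnectiveConstant ^ N := by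
  have hμ := hexConnectiveConstant_pos
  have hle : spliceE x δ N₀ N ≤ hexSawCount N := by
    by_cases h : N % 2 = δ % 2 ∧ N₀ ≤ N
    · rw [spliceE_of_class h]; exact_mod_cast card_endFin_le x N
    · rw [spliceE_of_not h]
  refine hle.trans ?_
  have hs1 : (1 : ℝ) ≤ Real.sqrt ((N : ℝ) + 1) := by
    rw [Real.le_sqrt (by norm_num) (by positivity)]; norm_num
  have hsN : Real.sqrt (N : ℝ) ≤ Real.sqrt ((N : ℝ) + 1) := Real.sqrt_le_sqrt (by linarith)
  rcases Nat.eq_zero_or_pos N with rfl | hN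
  · rw [hexSawCount_zero]
    simp only [Nat.cast_one, pow_zero, mul_one]
    exact Real.one_le_exp (by positivity)
  have hHW := hexHWExplicit_mu_six N hN
  have hμe : hexConnectiveConstant ≤ Real.exp 1 := by
    have h := hexConnectiveConstant_le.1
    have h2 : (2 : ℝ) ≤ Real.exp 1 := by have := Real.add_one_le_exp (1 : ℝ); linarith
    linarith
  calc (hexSawCount N : ℝ) ≤ hexConnectiveConstant * Real.exp (6 * Real.sqrt N) * hexConnectiveConstant ^ N := hHW
    _ ≤ Real.exp 1 * Real.exp (6 * Real.sqrt ((N : ℝ) + 1)) * hexConnectiveConstant ^ N := by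
        gcongr
    _ = Real.exp (1 + 6 * Real.sqrt ((N : ℝ) + 1)) * hexConnectiveConstant ^ N := by rw [Real.exp_add]
    _ ≤ Real.exp (7 * Real.sqrt ((N : ℝ) + 1)) * hexConnectiveConstant ^ N := by
        gcongr
        · linarith

end Splice

/-! ### The additive Kesten step for the spliced sequence, all `n ≥ 1` -/

section Additive

variable {x : HV} {c : ℝ} {δ : ℕ}

/-- **The additive two-step Kesten inequality for the spliced sequence, for ALL `n ≥ 1`**: both classes satisfy the multiplicative
inequality eventually (endpoint class `hexEndpointKestenTwo_of`, walk class `HV.kestenIneqHex`), the ratio limits give `φ ≥ 1`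
eventually, and the finitely many remaining indices (small or straddling the threshold) are absorbed into `B`.
[cite: MadrasSlade1993, Lemma 7.3.1 (7.3.3) and Theorem 7.3.2 (c)] -/
theorem spliceE_additive_all (hδ : δ ≤ 1) (hc : 0 ≤ c) (hLo : HexEndpointLo x c δ) {m₀ : ℕ}
    (hm₀ : ∀ m : ℕ, m₀ ≤ m →
      Real.exp (-(c * Real.sqrt ((2 * m + δ : ℕ) : ℝ))) * hexConnectiveConstant ^ (2 * m + δ) ≤ #(endFin x (2 * m + δ))) :
    ∃ B : ℝ, 1 ≤ B ∧ ∀ n : ℕ, 1 ≤ n →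
      spliceE x δ (2 * m₀ + δ) (n + 2) / spliceE x δ (2 * m₀ + δ) n - B / n ≤
        spliceE x δ (2 * m₀ + δ) (n + 4) / spliceE x δ (2 * m₀ + δ) (n + 2) := by
  set N₀ := 2 * m₀ + δ with hN₀
  set a : ℕ → ℝ := spliceE x δ N₀ with ha
  have hapos : ∀ n, 0 < a n := spliceE_pos hc hδ hm₀
  set φ : ℕ → ℝ := fun n => a (n + 2) / a n with hφ
  have hφpos : ∀ n, 0 < φ n := fun n => div_pos (hapos _) (hapos _)
  ---- endpoint class: eventual additive step in `m`
  obtain ⟨D₂, hD₂⟩ := hexEndpointKestenTwo_of hδ hc hLo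
  have hlimE := hexEndpointRatioTwo_of hδ hc hLo
  have h1E : ∀ᶠ m : ℕ in atTop, (1 : ℝ) ≤ (#(endFin x (2 * m + δ + 2)) : ℝ) / #(endFin x (2 * m + δ)) :=
    hlimE.eventually (eventually_ge_nhds (by have := Real.sqrt_nonneg 2; linarith))
  obtain ⟨m₁, hm₁⟩ := eventually_atTop.1 ((hD₂.and h1E).and (eventually_ge_atTop (max m₀ 1)))
  ---- walk class: eventual additive step in `N`
  obtain ⟨D₁, hD₁⟩ := kestenIneqHex
  have h1W : ∀ᶠ N : ℕ in atTop, (1 : ℝ) ≤ (hexSawCount (N + 2) : ℝ) / hexSawCount N :=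
    hexRatioTwo.eventually (eventually_ge_nhds (by have := Real.sqrt_nonneg 2; linarith))
  obtain ⟨N₁w, hN₁w⟩ := eventually_atTop.1 (hD₁.and h1W)
  ---- the threshold and the eventual additive step for the spliced sequence
  set B₀ : ℝ := max (max D₁ 0) (3 * max D₂ 0) with hB₀
  have hB₀0 : 0 ≤ B₀ := le_max_of_le_left (le_max_right _ _)
  set N₁ : ℕ := max (2 * m₁ + δ) N₁w + 1 with hN₁
  have hstep : ∀ n : ℕ, N₁ ≤ n → φ n - B₀ / n ≤ φ (n + 2) := by
    intro n hn
    have hn1 : (1 : ℝ) ≤ n := by exact_mod_cast (show 1 ≤ n by omega)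
    have hn0 : (0 : ℝ) < n := by linarith
    by_cases hcl : n % 2 = δ % 2
    · -- endpoint class: n = 2m + δ with m ≥ m₁ ≥ m₀, 1
      have hnN₀ : N₀ ≤ n := by
        have := (hm₁ m₁ le_rfl).2; omega
      obtain ⟨m, hm, rfl⟩ := exists_eq_of_class (m₀ := m₁) hδ ⟨hcl, by omega⟩
      obtain ⟨⟨hK, h1⟩, hmm⟩ := hm₁ m hm
      have hm0' : m₀ ≤ m := le_trans (le_max_left _ _) hmm
      have hm1' : 1 ≤ m := le_trans (le_max_right _ _) hmm
      have e0 : a (2 * m + δ) = #(endFin x (2 * m + δ)) := spliceE_of_class ⟨hcl, by omega⟩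
      have e2 : a (2 * m + δ + 2) = #(endFin x (2 * m + δ + 2)) :=
        spliceE_of_class ⟨by omega, by omega⟩
      have e4 : a (2 * m + δ + 2 + 2) = #(endFin x (2 * m + δ + 2 + 2)) :=
        spliceE_of_class ⟨by omega, by omega⟩
      have hφn : φ (2 * m + δ) = (#(endFin x (2 * m + δ + 2)) : ℝ) / #(endFin x (2 * m + δ)) := by
        simp only [hφ, e0, e2]
      have hφn2 : φ (2 * m + δ + 2) = (#(endFin x (2 * m + δ + 2 + 2)) : ℝ) / #(endFin x (2 * m + δ + 2)) := by
        simp only [hφ, e2, e4]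
      have hadd := sub_le_of_kesten_sq (n := m) h1 hK
      -- `max D₂ 0 / m ≤ B₀ / n` with `n = 2m+δ ≤ 3m`
      have hmr : (1 : ℝ) ≤ m := by exact_mod_cast hm1'
      have hnm : ((2 * m + δ : ℕ) : ℝ) ≤ 3 * m := by
        have : 2 * m + δ ≤ 3 * m := by omega
        exact_mod_cast this
      have hcmp : max D₂ 0 / m ≥ 0 := div_nonneg (le_max_right _ _) (by linarith)
      have hB : max D₂ 0 / (m : ℝ) ≤ B₀ / ((2 * m + δ : ℕ) : ℝ) := by
        rw [div_le_div_iff₀ (by linarith) (by positivity)]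
        have h3 : 3 * max D₂ 0 ≤ B₀ := le_max_right _ _
        have hD0 : 0 ≤ max D₂ 0 := le_max_right _ _
        nlinarith
      rw [hφn, hφn2]
      push_cast at hB ⊢
      linarith
    · -- walk class: all three spliced values are walk counts
      have e0 : a n = hexSawCount n := spliceE_of_not (fun h => hcl h.1)
      have e2 : a (n + 2) = hexSawCount (n + 2) := spliceE_of_not (fun h => hcl (by omega))
      have e4 : a (n + 4) = hexSawCount (n + 4) := spliceE_of_not (fun h => hcl (by omega))
      obtain ⟨hK, h1⟩ := hN₁w n (by omega)
      have hadd := sub_le_of_kesten_sq h1 hK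
      have hB : max D₁ 0 / (n : ℝ) ≤ B₀ / n := div_le_div_of_nonneg_right (le_max_left _ _) hn0.le
      simp only [hφ, e0, e2, e4, show n + 2 + 2 = n + 4 by ring]
      linarith
  ---- absorb the indices `n < N₁`
  obtain ⟨M, hM⟩ : ∃ M : ℝ, ∀ n : ℕ, n < N₁ → (n : ℝ) * φ n ≤ M := by
    obtain ⟨n₀, hn₀, hmax⟩ := Finset.exists_max_image (Finset.range N₁) (fun n : ℕ => (n : ℝ) * φ n)
      ⟨0, Finset.mem_range.2 (by omega)⟩
    exact ⟨(n₀ : ℝ) * φ n₀, fun n hn => hmax n (Finset.mem_range.2 hn)⟩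
  have hM0 : 0 ≤ M := le_trans (by simp) (hM 0 (by omega))
  refine ⟨max B₀ (M + 1), le_max_of_le_right (by linarith), fun n hn => ?_⟩
  have hn0 : (0 : ℝ) < n := by exact_mod_cast hn
  change φ n - max B₀ (M + 1) / n ≤ φ (n + 2)
  by_cases hsmall : n < N₁
  · have h1 : φ n ≤ (M + 1) / n := by
      rw [le_div_iff₀ hn0]
      have := hM n hsmall
      nlinarith [hφpos n]
    have h2 : (M + 1) / n ≤ max B₀ (M + 1) / n := div_le_div_of_nonneg_right (le_max_right _ _) hn0.le
    linarith [hφpos (n + 2)]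
  · push Not at hsmall
    have h2 : B₀ / n ≤ max B₀ (M + 1) / n := div_le_div_of_nonneg_right (le_max_left _ _) hn0.le
    linarith [hstep n hsmall]

end Additive

/-! ### The upper rate -/

section Rate

variable {x : HV} {c : ℝ} {δ : ℕ}

/-- **«HEX-ENDPOINT-RATIO-2-RATE», upper side (Kesten's exponent ¼) on `ℍ`**: given the envelope `HexEndpointLo x c δ`, there are
`K` and `m₁` with `#E_{2m+δ+2}(x)/#E_{2m+δ}(x) − (2+√2) ≤ K · m^{−1/4}` for all `m ≥ m₁`. Printed for `ℤ^d` ((7.5.2), Kesten 1963);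
first text for `ℍ`. [cite: MadrasSlade1993, §7.5 eq. (7.5.2) p. 255; Lemma 7.3.1 (proof)] [cite: Kesten1963SAW, §4]
[cite: DuminilCopinSmirnov2012, Theorem 1] -/
theorem hexEndpointRatioTwo_upperRate_of (hδ : δ ≤ 1) (hc : 0 ≤ c) (hLo : HexEndpointLo x c δ) :
    ∃ K : ℝ, ∃ m₁ : ℕ, ∀ m : ℕ, m₁ ≤ m →
      (#(endFin x (2 * m + δ + 2)) : ℝ) / #(endFin x (2 * m + δ)) - (2 + Real.sqrt 2) ≤
        K * (m : ℝ) ^ (-(1 : ℝ) / 4) := by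
  obtain ⟨m₀, hm₀⟩ := hLo
  set N₀ := 2 * m₀ + δ with hN₀
  set a : ℕ → ℝ := spliceE x δ N₀ with ha
  have hapos : ∀ n, 0 < a n := spliceE_pos hc hδ hm₀
  obtain ⟨B, hB1, hK⟩ := spliceE_additive_all hδ hc ⟨m₀, hm₀⟩ hm₀
  have hμ1 : (1 : ℝ) ≤ hexConnectiveConstant := one_le_hexConnectiveConstant
  obtain ⟨K, hKrate⟩ := Zd.KestenRateUpper.upper_rate_fourthRoot (a := a) (μ := hexConnectiveConstant) (B := B) (c := c)
    (C := 7) hapos hμ1 hB1 hc (by norm_num) hK (spliceE_lower hc hδ hm₀) (fun N => spliceE_upper N₀ N)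
  refine ⟨max K 0, max m₀ 1, fun m hm => ?_⟩
  have hmm₀ : m₀ ≤ m := le_trans (le_max_left _ _) hm
  have hm1 : 1 ≤ m := le_trans (le_max_right _ _) hm
  set N := 2 * m + δ with hN
  have hN1 : 1 ≤ N := by omega
  have eN : a N = #(endFin x N) := spliceE_of_class ⟨by omega, by omega⟩
  have eN2 : a (N + 2) = #(endFin x (N + 2)) := spliceE_of_class ⟨by omega, by omega⟩
  have hsq : hexConnectiveConstant ^ 2 = 2 + Real.sqrt 2 := hexConnectiveConstant_sq
  have hmr : (0 : ℝ) < m := by exact_mod_cast (show 0 < m by omega)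
  have hrpow0 : (0 : ℝ) ≤ (m : ℝ) ^ (-(1 : ℝ) / 4) := Real.rpow_nonneg hmr.le _
  -- the deviation
  set u : ℝ := (#(endFin x (N + 2)) : ℝ) / #(endFin x N) - (2 + Real.sqrt 2) with hu
  show u ≤ max K 0 * (m : ℝ) ^ (-(1 : ℝ) / 4)
  rcases le_or_gt u 0 with hu0 | hu0
  · exact hu0.trans (mul_nonneg (le_max_right _ _) hrpow0)
  have hdev : hexConnectiveConstant ^ 2 + u ≤ a (N + 2) / a N := by
    rw [eN, eN2, hsq, hu]; linarith
  have h1 := hKrate N hN1 u hu0 hdev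
  -- `N^{-1/4} ≤ m^{-1/4}` since `m ≤ N`
  have hmN : (m : ℝ) ≤ N := by exact_mod_cast (show m ≤ N by omega)
  have hNr : (0 : ℝ) < N := by linarith
  have hanti : (N : ℝ) ^ (-(1 : ℝ) / 4) ≤ (m : ℝ) ^ (-(1 : ℝ) / 4) := by
    rw [show (-(1 : ℝ) / 4) = -((1 : ℝ) / 4) by ring, Real.rpow_neg hNr.le, Real.rpow_neg hmr.le]
    exact inv_anti₀ (Real.rpow_pos_of_pos hmr _) (Real.rpow_le_rpow hmr.le hmN (by norm_num))
  calc u ≤ K * (N : ℝ) ^ (-(1 : ℝ) / 4) := h1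
    _ ≤ max K 0 * (N : ℝ) ^ (-(1 : ℝ) / 4) := mul_le_mul_of_nonneg_right (le_max_left _ _) (Real.rpow_nonneg hNr.le _)
    _ ≤ max K 0 * (m : ℝ) ^ (-(1 : ℝ) / 4) := mul_le_mul_of_nonneg_left hanti (le_max_right _ _)

/-- **The polygon upper rate on `ℍ`, NO hypotheses**: for each neighbour `z` of the origin, `#E_{2m+3}(z)/#E_{2m+1}(z) − (2+√2) ≤ K·m^{−1/4}`
for all large `m` (rooted `(2m+4)`-gons over rooted `(2m+2)`-gons through the edge `{0,z}`; envelope from `hexAdjEndLo`).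
[cite: MadrasSlade1993, §7.5 eq. (7.5.2) p. 255 and Theorem 7.3.4 (c) p. 248] [cite: Kesten1963SAW, §4] [cite: DuminilCopinSmirnov2012, Theorem 1] -/
theorem hexPolygonRatioTwo_upperRate {z : HV} (hz : hvGraph.Adj hvOrigin z) :
    ∃ K : ℝ, ∃ m₁ : ℕ, ∀ m : ℕ, m₁ ≤ m →
      (#(endFin z (2 * m + 1 + 2)) : ℝ) / #(endFin z (2 * m + 1)) - (2 + Real.sqrt 2) ≤ K * (m : ℝ) ^ (-(1 : ℝ) / 4) := by
  have hLo : HexEndpointLo z (Real.log 27060804 + 2 * (6 : ℕ) + 30 + 2) 1 := hexEndpointLo_of_adjEndLo hexAdjEndLo hz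
  have hc : (0 : ℝ) ≤ Real.log 27060804 + 2 * (6 : ℕ) + 30 + 2 := by
    have := Real.log_nonneg (show (1 : ℝ) ≤ 27060804 by norm_num); positivity
  exact hexEndpointRatioTwo_upperRate_of (δ := 1) le_rfl hc hLo

end Rate

end Literature.Probability.RandomPlanarGeometry.SAW.HV

end
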